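/-
Copyright (c) 2026. All rights reserved.
Released under Apache 2.0 license as described in the file LICENSE.
Authors: abc-iut cell, seat abc-iut-f-069 (gen 7; row «CT2b / G-L4t6g8-2 residual», file 6 of 6).
-/
import Literature.AnabelianGeometry.AbsoluteAnabelian.AbsTopII.DehnTwistEdgeTorusCentralizerCases
import HarnessLib

/-!
# The centraliser in `Π_𝔾` of a non-fibre element of the edge torus is `Π_e` (CT2); [AbsTopII] Prop 1.3 (viii′) at the nodal datum

S. Mochizuki, *Topics in Absolute Anabelian Geometry II* [AbsTopII] (`MochizukiAbsTopII2013`) §1 Prop 1.3 (viii) p. 12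
("`I_v = D_e ∩ D_{e'} ∩ Π_I`"), at the nodal Dehn-twist datum `dpsc i hi` (abc-iut-L4-t6 `DehnTwistLoopDatum`:
`Π_𝔾 = F̂₂ = ⟨a,b⟩^`, `Π_e = b^Ẑ`, `Π_v = ⟨b^Ẑ, ab^Ẑa⁻¹⟩^`, `Π_I = F̂₂ ⋊_{shear^i} Ẑ`).
PROOF-ONLY file (no definition, no instance, no notation), abc-iut-f-069 (gen 7); LAST file of the chain closing the
residual «CT2» of GAP row G-L4t6g8-2 = the displayed hypothesis of abc-iut-L4-t6's `prop_1_3_viii'_dpsc_of_CT2` (p487638):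
«`∀ u k x, k ≠ 1 → b^u ≠ 1 → b^u ≠ b^{k^i} → shear^i(k) x = b^{-u} x b^{u} → x ∈ Π_e`» — in `Π_I` the centraliser in
`Π_𝔾` of a NON-FIBRE element `(b^u, k)` of the edge torus `D_e ≅ Ẑ²` is `Π_e = b^Ẑ`.  L4-t6 proved the non-integral
slopes (`CT2_of_nonintegral`, p489641); this chain proves ALL slopes by a route with no profinite trees: the Fox `a`-chain of
`x` is a compatible family of `𝔽_ℓ`-chains on the finite quotients of `Π_I` (a `Ẑ`-valued measure), INVARIANT under the
affine dynamics `h ↦ z̄ h τ̄⁻¹`; a free `ℤ_ℓ`-dynamics kills invariant `𝔽_ℓ`-chains (`Ẑ` has no divisible elements); freeness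
is decided prime by prime in `Ẑ ≅ ∏_p ℤ_p` (files 1–5: `FoxChainPushforward`, `DehnTwistLevelFoxChains`,
`DehnTwistAffineOrbits`, `DehnTwistInvariantChainVanishing`, `DehnTwistEdgeTorusCentralizerCases`).
* `exists_theta0` — the involution `θ₀ : a ↦ a⁻¹, b ↦ b` of `F̂₂` (`θ₀ ∘ shear_κ = conj(b^{-κ}) ∘ shear_{κ⁻¹} ∘ θ₀`), which
  exchanges the two fibre directions of the edge torus and turns case C2 (`u ≡ m` at `ℓ`) into case C1 (`u ≡ 0`);
* ★ `CT2_holds` — **CT2 for every `i`, VERBATIM** (trichotomy at a prime `ℓ` seeing `m = k^i`: B / C1 / C2 of file 5);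
* ★ `prop_1_3_viii'_dpsc_holds` — **the typed [AbsTopII] Prop 1.3 (viii′) `DPSCIndexData.Prop_1_3_viii'` HOLDS at the nodal
  Dehn-twist datum `dpsc i hi` with NO hypothesis** (`prop_1_3_viii'_dpsc_of_CT2 hi CT2_holds`): every typed clause of
  [AbsTopII] Prop 1.3 now holds at a datum with a node.
HONEST FRAMING: classical profinite group theory under OUR kernel check, at a constructed model (constructed ≠ geometric; a
proof at a model is not a reconstruction); GAP row G-L4t6g8-2 closes AT THE MODEL; nothing here bears on [IUTchIII]
Cor 3.12; no side taken.
-/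

noncomputable section

open scoped Pointwise

namespace Literature.AnabelianGeometry.AbsoluteAnabelian.AbsTopII.DehnTwist

open Literature.AnabelianGeometry.EtaleTheta.SettingModel
open Literature.AnabelianGeometry.EtaleTheta
open Literature.AnabelianGeometry.AbsoluteAnabelian
open Function _root_.Topology

variable {i : ℕ}

/-! ### §1 The involution `θ₀ : a ↦ a⁻¹, b ↦ b` -/

/-- **The involution `θ₀ : a ↦ a⁻¹, b ↦ b` of `F̂₂`**: it fixes `b^Ẑ` pointwise, is involutive, and conjugates the RIGHT
shear `a ↦ a b^κ` to the LEFT shear: `θ₀(shear_κ y) = b^{-κ} · shear_{κ⁻¹}(θ₀ y) · b^{κ}` (check on `a`, `b`).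
[cite: MochizukiAbsTopII2013, Ex 1.1 (ii) p.9] -/
theorem exists_theta0 : ∃ θ : F₂hatT →ₜ* F₂hatT, θ genA = genA⁻¹ ∧ θ genB = genB ∧ (∀ y, θ (θ y) = y) ∧
    (∀ t : ZH, θ (bPow t) = bPow t) ∧
    ∀ (κ : ZH) (y : F₂hatT), θ (shear κ y) = (bPow κ)⁻¹ * shear κ⁻¹ (θ y) * bPow κ := by
  let θ : F₂hatT →ₜ* F₂hatT :=
    (ProfiniteGrp.ProfiniteCompletion.lift (P := F₂hat) (GrpCat.ofHom (FreeGroup.lift ![genA⁻¹, genB]))).hom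
  have hθ : ∀ g : F₂, θ (eta g) = FreeGroup.lift ![genA⁻¹, genB] g :=
    fun g => Literature.AnabelianGeometry.SemiGraphs.lift_hom_toCompletion F₂hat _ g
  have hθa : θ genA = genA⁻¹ := by
    show θ (eta (FreeGroup.of 0)) = _
    rw [hθ, FreeGroup.lift_apply_of]; rfl
  have hθb : θ genB = genB := by
    show θ (eta (FreeGroup.of 1)) = _
    rw [hθ, FreeGroup.lift_apply_of]; rfl
  -- `θ` fixes `b^Ẑ` pointwise: two continuous homomorphisms `Ẑ → F̂₂` agreeing at `1`
  have hθbPow : ∀ t : ZH, θ (bPow t) = bPow t := by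
    have h := ZHatCompletion.monoidHom_ext_of_continuous (f₁ := θ.toMonoidHom.comp bPow.toMonoidHom)
      (f₂ := bPow.toMonoidHom) (θ.continuous.comp bPow.continuous) bPow.continuous (by
        change θ (bPow (iotaZ (Multiplicative.ofAdd 1))) = bPow (iotaZ (Multiplicative.ofAdd 1))
        rw [bPow_iotaZ_one]; exact hθb)
    intro t
    exact DFunLike.congr_fun h t
  -- `θ ∘ θ = id`
  have hθθ : ∀ y, θ (θ y) = y := by
    have h : θ.comp θ = ContinuousMonoidHom.id F₂hatT := by
      refine ext_of_eta ?_ ?_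
      · show θ (θ genA) = genA
        rw [hθa, map_inv, hθa, inv_inv]
      · show θ (θ genB) = genB
        rw [hθb, hθb]
    intro y
    exact DFunLike.congr_fun h y
  refine ⟨θ, hθa, hθb, hθθ, hθbPow, fun κ => ?_⟩
  -- the shear relation, checked on generators
  let C : F₂hatT →ₜ* F₂hatT :=
    { toFun := fun y => (bPow κ)⁻¹ * y * bPow κ
      map_one' := by group
      map_mul' := fun y y' => by group
      continuous_toFun := (continuous_const.mul continuous_id).mul continuous_const }
  have hb : (bPow κ)⁻¹ * genB * bPow κ = genB := by
    change (bPow κ)⁻¹ * eta (FreeGroup.of 1) * bPow κ = eta (FreeGroup.of 1)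
    rw [← bPow_iotaZ_one, ← map_inv, ← map_mul, ← map_mul, (commute_zh κ⁻¹ _).eq, mul_assoc, inv_mul_cancel, mul_one]
  have h : θ.comp (shearEnd κ) = (C.comp (shearEnd κ⁻¹)).comp θ := by
    refine ext_of_eta ?_ ?_
    · show θ (shearEnd κ (eta (FreeGroup.of 0))) = (bPow κ)⁻¹ * shearEnd κ⁻¹ (θ genA) * bPow κ
      rw [shearEnd_eta_of_zero, map_mul, hθbPow, hθa, map_inv, shearEnd_eta_of_zero, mul_inv_rev, map_inv, inv_inv]
      change genA⁻¹ * bPow κ = (bPow κ)⁻¹ * (bPow κ * genA⁻¹) * bPow κ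
      group
    · show θ (shearEnd κ (eta (FreeGroup.of 1))) = (bPow κ)⁻¹ * shearEnd κ⁻¹ (θ genB) * bPow κ
      rw [shearEnd_eta_of_one, hθb, shearEnd_eta_of_one]
      exact hb.symm
  intro y
  exact DFunLike.congr_fun h y

/-- **Transport of the CT2 equation along `θ₀`**: if `shear^i(k) x = b^{-u} x b^{u}` then `x' = θ₀ x` satisfies
`shear^i(k⁻¹) x' = b^{-u'} x' b^{u'}` with `u' = u · (k^i)⁻¹` — the two fibre directions `u = 0`, `u = k^i` are exchanged.
[cite: MochizukiAbsTopII2013, Prop 1.3 (viii) p.12] -/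
theorem conj_shear_eq_of_theta {θ : F₂hatT →ₜ* F₂hatT} (hθbPow : ∀ t : ZH, θ (bPow t) = bPow t)
    (hθsh : ∀ (κ : ZH) (y : F₂hatT), θ (shear κ y) = (bPow κ)⁻¹ * shear κ⁻¹ (θ y) * bPow κ)
    {u k : ZH} {x : F₂hatT} (hx : shearPow i k x = (bPow u)⁻¹ * x * bPow u) :
    shearPow i k⁻¹ (θ x) = (bPow (u * (k ^ i)⁻¹))⁻¹ * θ x * bPow (u * (k ^ i)⁻¹) := by
  have h := congrArg θ hx
  rw [shearPow_apply, hθsh, map_mul, map_mul, map_inv, hθbPow] at h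
  rw [shearPow_apply, inv_pow, map_mul, map_inv]
  calc shear (k ^ i)⁻¹ (θ x)
      = bPow (k ^ i) * ((bPow (k ^ i))⁻¹ * shear (k ^ i)⁻¹ (θ x) * bPow (k ^ i)) * (bPow (k ^ i))⁻¹ := by group
    _ = bPow (k ^ i) * ((bPow u)⁻¹ * θ x * bPow u) * (bPow (k ^ i))⁻¹ := by rw [h]
    _ = (bPow u * (bPow (k ^ i))⁻¹)⁻¹ * θ x * (bPow u * (bPow (k ^ i))⁻¹) := by group

/-! ### §2 CT2 and [AbsTopII] Prop 1.3 (viii′) at the nodal datum -/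

/-- **CT2 (GAP row G-L4t6g8-2's residual, VERBATIM): in `Π_I = F̂₂ ⋊_{shear^i} Ẑ` the centraliser in `Π_𝔾 = F̂₂` of a
non-fibre element `(b^u, k)` of the edge torus is `Π_e = b^Ẑ`** — for ALL slopes, integral ones (`u ∈ (k^i)^Ẑ`) included.
Trichotomy at a prime `ℓ` at which `m = k^i` is not `ℓ`-divisible: if neither `u` nor `u m⁻¹` is `ℓ`-divisible, case B;
if `u` is, case C1; if `u m⁻¹` is, case C1 for `θ₀ x` (then `x = θ₀(θ₀ x) ∈ θ₀(b^Ẑ) = b^Ẑ`).  (For `k^i = 1` the twist is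
trivial and `x` commutes with `b^u ≠ 1`.) [cite: MochizukiAbsTopII2013, Prop 1.3 (viii) p.12] -/
theorem CT2_holds : ∀ (u k : ZH) (x : F₂hatT), k ≠ 1 → bPow u ≠ 1 → bPow u ≠ bPow (k ^ i) →
    shearPow i k x = (bPow u)⁻¹ * x * bPow u → x ∈ nodeGp := by
  intro u k x _hk hu hum hx
  by_cases hm1 : k ^ i = 1
  · -- trivial twist: `x` commutes with `b^u`
    have h0 : shearPow i k x = x := by
      change shearHom (k ^ i) x = x
      rw [hm1, map_one]; rfl
    rw [h0] at hx
    refine mem_nodeGp_of_commute_bPow hu ?_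
    calc x * bPow u = bPow u * ((bPow u)⁻¹ * x * bPow u) := by group
      _ = bPow u * x := by rw [← hx]
  obtain ⟨ℓ, hℓ, hmℓ⟩ := exists_prime_not_ellDiv hm1
  obtain ⟨K, hK⟩ := exists_hom_apply_eq k
  obtain ⟨U, hU⟩ := exists_hom_apply_eq u
  have hx' : shearPow i (K (iotaZ (Multiplicative.ofAdd 1))) x =
      (bPow (U (iotaZ (Multiplicative.ofAdd 1))))⁻¹ * x * bPow (U (iotaZ (Multiplicative.ofAdd 1))) := by
    rw [hK, hU]; exact hx
  by_cases huℓ : ∀ t : ℕ, ∃ μ : ZH, μ ^ (ℓ ^ t) = u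
  · -- case C1
    exact mem_nodeGp_of_conj_shear_eq_of_ellDiv hℓ U K (by rw [hK]; exact hmℓ) (by rw [hU]; exact huℓ)
      (by rw [hU]; exact hu) hx'
  by_cases humℓ : ∀ t : ℕ, ∃ μ : ZH, μ ^ (ℓ ^ t) = u * (k ^ i)⁻¹
  · -- case C2: transport along `θ₀` to case C1
    obtain ⟨θ, -, -, hθθ, hθbPow, hθsh⟩ := exists_theta0
    obtain ⟨K', hK'⟩ := exists_hom_apply_eq k⁻¹
    obtain ⟨U', hU'⟩ := exists_hom_apply_eq (u * (k ^ i)⁻¹)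
    have hx'' : shearPow i (K' (iotaZ (Multiplicative.ofAdd 1))) (θ x) =
        (bPow (U' (iotaZ (Multiplicative.ofAdd 1))))⁻¹ * θ x * bPow (U' (iotaZ (Multiplicative.ofAdd 1))) := by
      rw [hK', hU']; exact conj_shear_eq_of_theta hθbPow hθsh hx
    have hm' : ¬ ∀ t : ℕ, ∃ μ : ZH, μ ^ (ℓ ^ t) = K' (iotaZ (Multiplicative.ofAdd 1)) ^ i := by
      rw [hK', inv_pow]
      intro h
      apply hmℓ
      intro t
      obtain ⟨μ, hμ⟩ := h t
      exact ⟨μ⁻¹, by rw [inv_pow, hμ, inv_inv]⟩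
    have hu1' : bPow (U' (iotaZ (Multiplicative.ofAdd 1))) ≠ 1 := by
      rw [hU', map_mul, map_inv]
      intro h
      exact hum (mul_inv_eq_one.mp h)
    have hmem := mem_nodeGp_of_conj_shear_eq_of_ellDiv hℓ U' K' hm' (by rw [hU']; exact humℓ) hu1' hx''
    obtain ⟨t, ht⟩ := (mem_bAxis_iff _).mp (show θ x ∈ bAxis from hmem)
    show x ∈ bAxis
    rw [← hθθ x, ← ht, hθbPow]
    exact bPow_mem_bAxis t
  · -- case B
    exact mem_nodeGp_of_conj_shear_eq_of_not_ellDiv hℓ U K (by rw [hK]; exact hmℓ) (by rw [hU]; exact huℓ)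
      (by rw [hU, hK]; exact humℓ) hx'

/-- **[AbsTopII] Prop 1.3 (viii′) — the typed `DPSCIndexData.Prop_1_3_viii'` — HOLDS at the nodal Dehn-twist datum
`dpsc i hi` with NO hypothesis**: abc-iut-L4-t6's `prop_1_3_viii'_dpsc_of_CT2` (p487638) with its single displayed input CT2
now a theorem (`CT2_holds`).  Constructed ≠ geometric; a proof at a model is not a reconstruction of the geometric datum.
[cite: MochizukiAbsTopII2013, Prop 1.3 (viii) p.12] -/
theorem prop_1_3_viii'_dpsc_holds (hi : 0 < i) :
    Literature.AnabelianGeometry.AbsoluteAnabelian.AbsTopII.DPSCIndexData.Prop_1_3_viii' (dpsc i hi) :=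
  prop_1_3_viii'_dpsc_of_CT2 hi CT2_holds

end Literature.AnabelianGeometry.AbsoluteAnabelian.AbsTopII.DehnTwist
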